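import Mathlib
import Summits.NavierStokesRegularity.NavierStokesRegularity.Theorems.EulerZoomLiouvillePowerGaugeEulerLiouvilleNeedleClockPast
import HarnessLib

/-!
# «ONE CLOCKED BALL KILLS»: the waiting-time threshold of the needle race is LOCAL
# (crux `EulerZoomLiouville.PowerGaugeEulerLiouville` = stmt-NavierStokesRegularity-19832, THE ONE STATEMENT `stub_selfSimilarC2Needle`; binder `HasResidenceClock` alt 6)

Route `EulerZoomLiouville` (NavierStokesRegularity), crux E, LEAD seat ns-typeII-p2 g13 (own brick #5).  In ns-ezl-w2 g3's threshold
`NeedleRace.curl_eq_zero_of_powerClock_of_strongThinExits` (`…NeedleClockThreshold`, ROUND-38 (T_pow) ∘ (K″)) the vorticity of the blob centre `x₀`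
is used ONLY to invoke the clock hypothesis: the exit half `vol(B₀ ∖ Stay) ≤ A/R` of the waiting-time law holds for EVERY ball `B₀ = B(x₀, r)` of every
`C²` divergence-free profile with STRONG thin fast exits.  Hence a residence clock AT ONE BALL — `x₀` arbitrary, vortical or not, near or far — already
contradicts (K″):

* `NeedleRace.false_of_powerClockAt_of_strongThinExits` — profile level: (K″) + a clock of strength `c′R^e` (`6γc′ < β`) at ONE ball ⇒ `False`
  (the proof of the threshold verbatim, minus `by_contra`);
* `NeedleRace.selfSimilar_ae_eq_zero_of_localPowerClockC2` / `…_past` — member level (crux hypotheses verbatim, `0 < ρ ≤ ½`, exact self-similarity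
  about the origin / about `(T, x₀)` for `τ < T₁`, `V ∈ C²`): the hypothesis `hclock` of `…subcriticalClockC2` / `…_past` with
  `∀ x₀, curl V x₀ ≠ 0 → ∃ r …` REPLACED BY `∃ x₀ r …` (for every `c′ > 0` SOME ball, at most half of whose labels stay in `‖·‖ ≤ 2R` during backward
  similarity time `c′R^{2+ρ}`, all large `R`, every cut-off copy) ⇒ `u = 0` a.e.  A local LOG clock (`s₁ log R`) is a local power clock for every `c′`.

For the skeleton (LEAD, v88): `HasResidenceClock ρ V` gains ALTERNATIVE 6 = the local power clock (fillers: these two theorems).  For mechanism hunters: a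
channel / band deficit / invariant inflow cone need only hold ALONG THE BACKWARD ORBITS ISSUING FROM ONE BALL, not at every far vortical Bernoulli-high point.
WHAT THIS IS NOT: not NS, not E — the waiting-time law read locally; no new estimate; DENT 0 on the registered stubs; 19832 OPEN; NS regularity is NOT
proved. [folklore; ConstantinIgnatovaVicol2026Putative §3.5]
-/

noncomputable section

-- flat `Theorems/<Route><Decl>…` files of one crux share the namespace of the crux (tree convention: `Summit.<S>.<S>.…`)
set_option linter.dupNamespace false

open Set Filter Topology Metric Function MeasureTheory InnerProductSpace
open scoped RealInnerProductSpace NNReal ENNReal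

namespace Summit.NavierStokesRegularity.NavierStokesRegularity.Theorems.PowerGaugeEulerLiouville.NeedleRace

open Literature.Analysis Literature.Analysis.FluidPDE Literature.Analysis.FunctionSpaces
open Summit.NavierStokesRegularity.NavierStokesRegularity.Theorems.PowerGaugeEulerLiouville

section Profile

variable {γ : ℝ} {U : EuclideanSpace ℝ (Fin 3) → EuclideanSpace ℝ (Fin 3)}

/-- **A RESIDENCE CLOCK AT ONE BALL CONTRADICTS THE STRONG THIN FAST EXITS** (`U ∈ C²` divergence-free, `γ > 0`; (K″) thin-exit data of size
`C R⁴ e^{−βR^e}` for every `R ≥ 1`; `0 ≤ c′`, `6γc′ < β`; ONE ball `B(x₀, r)`, `x₀` ARBITRARY, at most half of whose labels stay in `‖·‖ ≤ 2R` during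
backward similarity time `c′R^e`, for all `R ≥ R₁` and every cut-off copy).  = `curl_eq_zero_of_powerClock_of_strongThinExits` read locally: its proof
never uses the vorticity of `x₀`. [folklore; ConstantinIgnatovaVicol2026Putative §3.5] -/
theorem false_of_powerClockAt_of_strongThinExits (hU2 : ContDiff ℝ 2 U) (hdivU : VectorCalculus.IsDivFree U)
    (hγ : 0 < γ) {κ : ℝ} (hκ : 0 < κ) {e β C : ℝ} (he : 1 ≤ e) (hC : 0 ≤ C)
    (hthinS : ∀ R : ℝ, 1 ≤ R →
      ∃ (G : Set ℝ) (N : Set (EuclideanSpace ℝ (Fin 3))),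
        MeasurableSet G ∧ G ⊆ Icc (R ^ 2) ((2 * R) ^ 2) ∧ κ * R ^ 2 ≤ (volume G).toReal ∧
        MeasurableSet N ∧ N ⊆ closedBall (0 : EuclideanSpace ℝ (Fin 3)) (2 * R) ∧
        (∀ z : EuclideanSpace ℝ (Fin 3), ‖z‖ ^ 2 ∈ G → ⟪U z, z⟫ + γ * ‖z‖ ^ 2 < 0 → z ∈ N) ∧
        volume N * ∫⁻ z in N, ENNReal.ofReal (‖U z‖ ^ 2) ≤
          ENNReal.ofReal (C * R ^ (4 : ℝ) * Real.exp (-(β * R ^ e))))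
    {c' : ℝ} (hc' : 0 ≤ c') (hβc : 6 * γ * c' < β)
    {x₀ : EuclideanSpace ℝ (Fin 3)} {r : ℝ} (hr : 0 < r) {R₁ : ℝ}
    (hR₁ : ∀ R : ℝ, R₁ ≤ R →
      ∀ (V : EuclideanSpace ℝ (Fin 3) → EuclideanSpace ℝ (Fin 3)) (K Rbig : ℝ), ContDiff ℝ 2 V →
        (∀ y, ‖fderiv ℝ V y‖ ≤ K) → 2 * R < Rbig →
        (∀ w ∈ ball (0 : EuclideanSpace ℝ (Fin 3)) Rbig, V w = U w) →
        (volume (ball x₀ r ∩ {y | ∀ σ ∈ Icc 0 (c' * R ^ e),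
          ‖ODE.evolutionMap (fun _ : ℝ => selfSimilarTransport γ 0 V) 0 (-σ) y‖ ≤ 2 * R})).toReal ≤
          (volume (ball x₀ r)).toReal / 2) : False := by
  have hδ : 0 < β / 2 - 3 * γ * c' := by linarith
  set δ : ℝ := β / 2 - 3 * γ * c' with hδdef
  -- ### the blob (the clock is the hypothesis `hR₁`)
  set B₀ : Set (EuclideanSpace ℝ (Fin 3)) := ball x₀ r with hB₀
  have hB₀m : MeasurableSet B₀ := measurableSet_ball
  have hv₀pos : 0 < volume B₀ := measure_ball_pos volume x₀ hr
  have hv₀top : volume B₀ < ⊤ := measure_ball_lt_top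
  set v₀ : ℝ := (volume B₀).toReal with hv₀
  have hv₀0 : 0 < v₀ := ENNReal.toReal_pos hv₀pos.ne' hv₀top.ne
  -- ### the radius
  set A : ℝ := 8 * Real.sqrt C / (3 * γ * κ * δ ^ 2) with hA
  have hA0 : 0 ≤ A := by rw [hA]; positivity
  set R : ℝ := max (max R₁ 1) (max (‖x₀‖ + r) (2 * A / v₀ + 1)) with hRdef
  have hRR₁ : R₁ ≤ R := (le_max_left _ _).trans (le_max_left _ _)
  have hR1 : 1 ≤ R := (le_max_right _ _).trans (le_max_left _ _)
  have hRx : ‖x₀‖ + r ≤ R := (le_max_left _ _).trans (le_max_right _ _)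
  have hRv : 2 * A / v₀ + 1 ≤ R := (le_max_right _ _).trans (le_max_right _ _)
  have hR0 : 0 < R := by linarith
  obtain ⟨G, N, hGm, hG, hGvol, hNm, hNsub, hLemK, hNJ⟩ := hthinS R hR1
  set S : ℝ := c' * R ^ e with hSdef
  have hS : 0 ≤ S := mul_nonneg hc' (Real.rpow_nonneg hR0.le _)
  -- ### the cut-off field
  set Rbig : ℝ := 2 * R + 1 with hRbigdef
  obtain ⟨V, hV2, -, -, ⟨K, hK⟩, hVU⟩ := Loc.exists_cutoff_local hU2 (R := Rbig) (by positivity)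
  have hRbig : 2 * R < Rbig := by rw [hRbigdef]; linarith
  have hdiv : ∀ z : EuclideanSpace ℝ (Fin 3), ‖z‖ ≤ 2 * R → VectorCalculus.divergence V z = 0 := by
    intro z hz
    have hzball : z ∈ ball (0 : EuclideanSpace ℝ (Fin 3)) Rbig := mem_ball_zero_iff.2 (by linarith)
    have hev : V =ᶠ[𝓝 z] U := by
      filter_upwards [isOpen_ball.mem_nhds hzball] with w hw using hVU w hw
    unfold VectorCalculus.divergence
    rw [hev.fderiv_eq]
    exact hdivU z
  set Φ := ODE.evolutionMap (fun _ : ℝ => selfSimilarTransport γ 0 V) 0 with hΦ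
  -- ### the blob sits in `B̄_R`
  have hB₀R : B₀ ⊆ closedBall (0 : EuclideanSpace ℝ (Fin 3)) R := by
    intro y hy
    rw [hB₀, mem_ball] at hy
    rw [mem_closedBall_zero_iff]
    have h1 : ‖y‖ ≤ ‖y - x₀‖ + ‖x₀‖ := norm_le_norm_sub_add y x₀
    rw [← dist_eq_norm] at h1
    linarith
  -- ### the two halves
  set Stay : Set (EuclideanSpace ℝ (Fin 3)) := {y | ∀ σ ∈ Icc 0 S, ‖Φ (-σ) y‖ ≤ 2 * R} with hStay
  have hStaym : MeasurableSet Stay := (isClosed_backwardStay (γ := γ) hV2 hK S (2 * R)).measurableSet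
  have h1 : (volume (B₀ ∩ Stay)).toReal ≤ v₀ / 2 := hR₁ R hRR₁ V K Rbig hV2 hK hRbig hVU
  -- exit half: feeding law + bookkeeping + the power-clock arithmetic
  have h2raw := ofReal_mul_volume_exit_le (γ := γ) (U := U) hV2 hK hγ hR0 hRbig hVU hdiv hS hB₀m hB₀R hGm hG
    hNm hNsub hLemK
  set cS : ℝ := (Real.exp (3 * γ * S) - 1) / (3 * γ) with hcS
  have hcS0 : 0 ≤ cS := by
    rw [hcS]
    apply div_nonneg _ (by positivity)
    have : 1 ≤ Real.exp (3 * γ * S) := Real.one_le_exp (by positivity)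
    linarith
  set g : ℝ := (volume G).toReal / (4 * R) with hg
  have hgκ : κ * R / 4 ≤ g := by
    rw [hg, le_div_iff₀ (by positivity)]
    nlinarith [hGvol, hR0, hκ]
  have hgpos : 0 < g := lt_of_lt_of_le (by positivity) hgκ
  have hε0 : 0 ≤ C * R ^ (4 : ℝ) * Real.exp (-(β * R ^ e)) := by positivity
  have h3 := toReal_le_of_feeding (N := N) hgpos hcS0 hε0 h2raw hNJ
  have h2 : (volume (B₀ \ Stay)).toReal ≤ A / R := by
    refine h3.trans ?_
    have h4 : cS * Real.sqrt (C * R ^ (4 : ℝ) * Real.exp (-(β * R ^ e))) / g ≤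
        cS * Real.sqrt (C * R ^ (4 : ℝ) * Real.exp (-(β * R ^ e))) / (κ * R / 4) :=
      div_le_div_of_nonneg_left (by positivity) (by positivity) hgκ
    refine h4.trans ?_
    have h5 : cS * Real.sqrt (C * R ^ (4 : ℝ) * Real.exp (-(β * R ^ e))) / (κ * R / 4) =
        4 / (κ * R) * cS * Real.sqrt (C * R ^ (4 : ℝ) * Real.exp (-(β * R ^ e))) := by
      field_simp
    rw [h5, hcS, hSdef]
    have h6 := exit_arith_powerClock (C := C) hγ hκ he hR1 hδ
    rw [← hδdef] at h6
    refine h6.trans (le_of_eq ?_)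
    rw [hA]
    field_simp
  -- `A/R < v₀/2`
  have h3' : A / R < v₀ / 2 := by
    rw [div_lt_iff₀ hR0]
    have : 2 * A / v₀ < R := by linarith
    rw [div_lt_iff₀ hv₀0] at this
    linarith
  -- ### the sum
  have hsplit : volume (B₀ ∩ Stay) + volume (B₀ \ Stay) = volume B₀ := measure_inter_add_sdiff B₀ hStaym
  have hfin1 : volume (B₀ ∩ Stay) ≠ ⊤ := ((measure_mono inter_subset_left).trans_lt hv₀top).ne
  have hfin2 : volume (B₀ \ Stay) ≠ ⊤ := ((measure_mono Set.sdiff_subset).trans_lt hv₀top).ne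
  have hsum : v₀ = (volume (B₀ ∩ Stay)).toReal + (volume (B₀ \ Stay)).toReal := by
    rw [hv₀, ← hsplit, ENNReal.toReal_add hfin1 hfin2]
  linarith

end Profile

section Member

variable {V : EuclideanSpace ℝ (Fin 3) → EuclideanSpace ℝ (Fin 3)}

/-- **«ONE CLOCKED BALL KILLS» (member level).**  An exactly self-similar member of the window class (`0 < ρ ≤ ½`, crux hypotheses verbatim) with a
`C²` velocity profile carrying, for EVERY `c′ > 0`, a residence clock of strength `c′R^{2+ρ}` AT SOME BALL (centre arbitrary) is trivial.
= `selfSimilar_ae_eq_zero_of_subcriticalClockC2` with `∀ x₀, curl V x₀ ≠ 0 → ∃ r …` replaced by `∃ x₀ r …`. [folklore; ConstantinIgnatovaVicol2026Putative §3.5] -/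
theorem selfSimilar_ae_eq_zero_of_localPowerClockC2 {ρ : ℝ} (hρ : 0 < ρ) (hρ1 : ρ ≤ 1 / 2)
    {u : ℝ → EuclideanSpace ℝ (Fin 3) → EuclideanSpace ℝ (Fin 3)} {p : ℝ → EuclideanSpace ℝ (Fin 3) → ℝ}
    {H : ℝ → EuclideanSpace ℝ (Fin 3) → EuclideanSpace ℝ (Fin 3) →L[ℝ] EuclideanSpace ℝ (Fin 3)} {c : ℝ≥0}
    (hsw : IsSuitableWeakSolutionOn (slab (EuclideanSpace ℝ (Fin 3)) (Iio 0) isOpen_Iio) 0 0 u p)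
    (hH : HasWeakSpatialGradientOn (slab (EuclideanSpace ℝ (Fin 3)) (Iio 0) isOpen_Iio) u H)
    (hgauge : ∀ a : ℝ, 0 < a →
      ENNReal.ofReal (a ^ (2 * ρ)) * cknA a (0 : ℝ × EuclideanSpace ℝ (Fin 3)) u +
          ENNReal.ofReal (a ^ ρ) * cknE a (0 : ℝ × EuclideanSpace ℝ (Fin 3)) H +
        ENNReal.ofReal (a ^ (2 * ρ)) * cknD a (0 : ℝ × EuclideanSpace ℝ (Fin 3)) p ≤ (c : ℝ≥0∞))
    {P : EuclideanSpace ℝ (Fin 3) → ℝ}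
    (hu : ∀ τ : ℝ, τ < 0 → u τ = selfSimilarCollapse (1 / (2 + ρ)) 0 V τ)
    (hp : ∀ τ : ℝ, τ < 0 → p τ = selfSimilarCollapsePressure (1 / (2 + ρ)) 0 P τ)
    (hV : ContDiff ℝ 2 V)
    (hclock : ∀ c' : ℝ, 0 < c' → ∃ x₀ : EuclideanSpace ℝ (Fin 3), ∃ r : ℝ, 0 < r ∧ ∃ R₀ : ℝ,
      ∀ R : ℝ, R₀ ≤ R → ∀ (V' : EuclideanSpace ℝ (Fin 3) → EuclideanSpace ℝ (Fin 3)) (K Rbig : ℝ), ContDiff ℝ 2 V' →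
        (∀ y, ‖fderiv ℝ V' y‖ ≤ K) → 2 * R < Rbig →
        (∀ w ∈ ball (0 : EuclideanSpace ℝ (Fin 3)) Rbig, V' w = V w) →
        (volume (ball x₀ r ∩ {y | ∀ σ ∈ Icc 0 (c' * R ^ (2 + ρ)),
          ‖ODE.evolutionMap (fun _ : ℝ => selfSimilarTransport (1 / (2 + ρ)) 0 V') 0 (-σ) y‖ ≤ 2 * R})).toReal ≤
          (volume (ball x₀ r)).toReal / 2) :
    uncurry u =ᵐ[volume.restrict (Iio (0 : ℝ) ×ˢ (univ : Set (EuclideanSpace ℝ (Fin 3))))] 0 := by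
  have hρ1' : ρ < 1 := by linarith
  have h2ρ : (0 : ℝ) < 2 + ρ := by linarith
  have hγ : (0 : ℝ) < 1 / (2 + ρ) := one_div_pos.2 h2ρ
  have h1ρ : 0 ≤ 1 - ρ := by linarith
  have hA : ∀ a : ℝ, 0 < a → ENNReal.ofReal (a ^ (2 * ρ)) *
      cknA a (0 : ℝ × EuclideanSpace ℝ (Fin 3)) u ≤ (c : ℝ≥0∞) :=
    fun a ha => le_trans (le_trans le_self_add le_self_add) (hgauge a ha)
  -- divergence-free profile and the class budgets on closed balls (as in `thinFastExits_of_selfSimilarC2`)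
  obtain ⟨hdiv, -⟩ := thinFastExits_of_selfSimilarC2 hρ hρ1 hsw hH hgauge hu hp hV
  obtain ⟨hA', hE'⟩ :=
    NeedleThinCore.selfSimilar_needle_inputs hρ hρ1' hsw hH hgauge hu hp (hV.of_le one_le_two)
  have hbA : ∀ L : ℝ, 1 ≤ L →
      ∫⁻ z in closedBall (0 : EuclideanSpace ℝ (Fin 3)) L, ‖V z‖ₑ ^ 2 ≤
        ENNReal.ofReal ((c : ℝ) * 2 ^ (1 - 2 * ρ) * L ^ (1 - 2 * ρ)) := by
    intro L hL
    have hL0 : 0 < L := by linarith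
    calc ∫⁻ z in closedBall (0 : EuclideanSpace ℝ (Fin 3)) L, ‖V z‖ₑ ^ 2
        ≤ ∫⁻ z in ball (0 : EuclideanSpace ℝ (Fin 3)) (2 * L), ‖V z‖ₑ ^ 2 :=
          lintegral_mono_set (closedBall_subset_ball (by linarith))
      _ ≤ (c : ℝ≥0∞) * ENNReal.ofReal ((2 * L) ^ (1 - 2 * ρ)) := hA' (2 * L) (by linarith)
      _ = ENNReal.ofReal ((c : ℝ) * 2 ^ (1 - 2 * ρ) * L ^ (1 - 2 * ρ)) := by
          rw [Real.mul_rpow two_pos.le hL0.le, ← ENNReal.ofReal_coe_nnreal,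
            ← ENNReal.ofReal_mul (NNReal.coe_nonneg c)]
          congr 1
          ring
  have hE0 : 0 ≤ (1 - ρ) / (2 + ρ) * (c : ℝ) := by positivity
  have hbE : ∀ L : ℝ, 1 ≤ L →
      ∫⁻ z in closedBall (0 : EuclideanSpace ℝ (Fin 3)) L, ‖fderiv ℝ V z‖ₑ ^ 2 ≤
        ENNReal.ofReal ((1 - ρ) / (2 + ρ) * (c : ℝ) * L ^ (1 - ρ)) :=
    fun L hL => lintegral_fderiv_sq_closedBall_le hρ1' hE0 hE' hL
  -- (K″): strong thin exits
  obtain ⟨β, hβ, C, hC, hthinS⟩ :=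
    NeedleFastSetMeasure.thinFastExits_strong' (hV.of_le (by norm_num)) hγ hρ.le hρ1 (by positivity) hE0 hbA hbE
  -- the clock at strength `c′ = β/(12γ)`, so that `6γc′ = β/2 < β`
  set c' : ℝ := β / (12 * (1 / (2 + ρ))) with hc'
  have hc'0 : 0 < c' := by rw [hc']; positivity
  have hβc : 6 * (1 / (2 + ρ)) * c' < β := by
    rw [hc']
    field_simp
    nlinarith [hβ, h2ρ]
  obtain ⟨x₀, r, hr, R₀, hR₀⟩ := hclock c' hc'0
  exact (false_of_powerClockAt_of_strongThinExits (γ := 1 / (2 + ρ)) (e := 2 + ρ) hV hdiv hγ one_pos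
    (by linarith) hC hthinS hc'0.le hβc hr hR₀).elim

end Member

section Past

variable {ρ T T₁ : ℝ} {V : EuclideanSpace ℝ (Fin 3) → EuclideanSpace ℝ (Fin 3)}
  {u : ℝ → EuclideanSpace ℝ (Fin 3) → EuclideanSpace ℝ (Fin 3)} {p : ℝ → EuclideanSpace ℝ (Fin 3) → ℝ}
  {H : ℝ → EuclideanSpace ℝ (Fin 3) → EuclideanSpace ℝ (Fin 3) →L[ℝ] EuclideanSpace ℝ (Fin 3)} {c : ℝ≥0}
  {P : EuclideanSpace ℝ (Fin 3) → ℝ}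

/-- **«ONE CLOCKED BALL KILLS», PAST-EXACT TWIN.**  Crux hypotheses verbatim (`0 < ρ ≤ ½`) + exact self-similarity about `(T, x₀)` for `τ < T₁`
(`T₁ ≤ 0`, `T₁ ≤ T`) + a `C²` profile with, for EVERY `c′ > 0`, a residence clock of strength `c′R^{2+ρ}` AT SOME BALL `B(x₁, r)` ⇒ `u = 0` a.e.
= `selfSimilar_ae_eq_zero_of_subcriticalClockC2_past` with `∀ x₀, curl V x₀ ≠ 0 → ∃ r …` replaced by `∃ x₁ r …`. [folklore; ConstantinIgnatovaVicol2026Putative §3.5] -/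
theorem selfSimilar_ae_eq_zero_of_localPowerClockC2_past (hρ : 0 < ρ) (hρh : ρ ≤ 1 / 2) (hT₁ : T₁ ≤ 0)
    (hTT₁ : T₁ ≤ T) (x₀ : EuclideanSpace ℝ (Fin 3))
    (hsw : IsSuitableWeakSolutionOn (slab (EuclideanSpace ℝ (Fin 3)) (Iio 0) isOpen_Iio) 0 0 u p)
    (hH : HasWeakSpatialGradientOn (slab (EuclideanSpace ℝ (Fin 3)) (Iio 0) isOpen_Iio) u H)
    (hgauge : ∀ a : ℝ, 0 < a →
      ENNReal.ofReal (a ^ (2 * ρ)) * cknA a (0 : ℝ × EuclideanSpace ℝ (Fin 3)) u +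
          ENNReal.ofReal (a ^ ρ) * cknE a (0 : ℝ × EuclideanSpace ℝ (Fin 3)) H +
        ENNReal.ofReal (a ^ (2 * ρ)) * cknD a (0 : ℝ × EuclideanSpace ℝ (Fin 3)) p ≤ (c : ℝ≥0∞))
    (hu : ∀ τ : ℝ, τ < T₁ → u τ = fun x => selfSimilarCollapse (1 / (2 + ρ)) T V τ (x - x₀))
    (hp : ∀ τ : ℝ, τ < T₁ → p τ = fun x => selfSimilarCollapsePressure (1 / (2 + ρ)) T P τ (x - x₀))
    (hV : ContDiff ℝ 2 V)
    (hclock : ∀ c' : ℝ, 0 < c' → ∃ x₁ : EuclideanSpace ℝ (Fin 3), ∃ r : ℝ, 0 < r ∧ ∃ R₀ : ℝ,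
      ∀ R : ℝ, R₀ ≤ R → ∀ (V' : EuclideanSpace ℝ (Fin 3) → EuclideanSpace ℝ (Fin 3)) (K Rbig : ℝ), ContDiff ℝ 2 V' →
        (∀ y, ‖fderiv ℝ V' y‖ ≤ K) → 2 * R < Rbig →
        (∀ w ∈ ball (0 : EuclideanSpace ℝ (Fin 3)) Rbig, V' w = V w) →
        (volume (ball x₁ r ∩ {y | ∀ σ ∈ Icc 0 (c' * R ^ (2 + ρ)),
          ‖ODE.evolutionMap (fun _ : ℝ => selfSimilarTransport (1 / (2 + ρ)) 0 V') 0 (-σ) y‖ ≤ 2 * R})).toReal ≤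
          (volume (ball x₁ r)).toReal / 2) :
    uncurry u =ᵐ[volume.restrict (Iio (0 : ℝ) ×ˢ (univ : Set (EuclideanSpace ℝ (Fin 3))))] 0 := by
  have h2ρ : (0 : ℝ) < 2 + ρ := by linarith
  have hγ : (0 : ℝ) < 1 / (2 + ρ) := one_div_pos.2 h2ρ
  have hA : ∀ a : ℝ, 0 < a → ENNReal.ofReal (a ^ (2 * ρ)) *
      cknA a (0 : ℝ × EuclideanSpace ℝ (Fin 3)) u ≤ (c : ℝ≥0∞) :=
    fun a ha => le_trans (le_trans le_self_add le_self_add) (hgauge a ha)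
  have hE : ∀ a : ℝ, 0 < a → ENNReal.ofReal (a ^ ρ) *
      cknE a (0 : ℝ × EuclideanSpace ℝ (Fin 3)) H ≤ (c : ℝ≥0∞) :=
    fun a ha => le_trans (le_trans le_add_self le_self_add) (hgauge a ha)
  -- divergence-free profile and the class budgets on closed balls
  obtain ⟨hdiv, cA, cE, hcA, hcE, hbA, hbE⟩ :=
    needleBudgets_of_selfSimilarC2_past hρ hρh hT₁ hTT₁ x₀ hsw.distributional hH hA hE hu hp hV
  -- (K″): strong thin exits
  obtain ⟨β, hβ, C, hC, hthinS⟩ :=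
    NeedleFastSetMeasure.thinFastExits_strong' (hV.of_le (by norm_num)) hγ hρ.le hρh hcA hcE hbA hbE
  -- the clock at strength `c′ = β/(12γ)`, so that `6γc′ = β/2 < β`
  set c' : ℝ := β / (12 * (1 / (2 + ρ))) with hc'
  have hc'0 : 0 < c' := by rw [hc']; positivity
  have hβc : 6 * (1 / (2 + ρ)) * c' < β := by
    rw [hc']
    field_simp
    nlinarith [hβ, h2ρ]
  obtain ⟨x₁, r, hr, R₀, hR₀⟩ := hclock c' hc'0
  exact (false_of_powerClockAt_of_strongThinExits (γ := 1 / (2 + ρ)) (e := 2 + ρ) hV hdiv hγ one_pos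
    (by linarith) hC hthinS hc'0.le hβc hr hR₀).elim

end Past

end Summit.NavierStokesRegularity.NavierStokesRegularity.Theorems.PowerGaugeEulerLiouville.NeedleRace

end
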